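import Mathlib.NumberTheory.MahlerMeasure
import Mathlib.RingTheory.Polynomial.UniqueFactorization
import Mathlib.FieldTheory.IsAlgClosed.Basic
import Mathlib.Analysis.Complex.Polynomial.Basic
import Literature.Computability.AlgebraicComplexity.BurgisserReductionModPrimes
import HarnessLib

/-!
# Weights of univariate integer polynomials, Mignotte's factor bound, and the numerator polynomial

Trunk T-CPLX-ALG. The elementary (proved) ingredients of Bürgisser's Theorem 4.5 (*Cook's versus
Valiant's hypothesis*, TCS 235 (2000), p. 82; the named fact `algebraicSolution_height_bound` of
`BurgisserReductionModPrimes.lean`), i.e. everything the printed proof uses besides its two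
geometric inputs (Lemmas 4.3–4.4: reduction to `n` equations with finite zero set; Krick–Pardo's
Prop. 27 with Lemma 2.4: the arithmetic shape lemma), from which Thm. 4.5 then follows by the
bookkeeping of p. 82:

* the `ℓ¹`-API of `polyWeight` (Bürgisser p. 76: the weight is subadditive and
  submultiplicative): `polyWeight_add_le`, `polyWeight_mul_le`, `polyWeight_C_mul`,
  `polyWeight_mul_X_pow`, sums, products, powers;
* degree and weight of the division-free numerator `numeratorPoly f D λ v = λ^D f(λ⁻¹ v(Y))`
  (Bürgisser p. 82: "`deg G_i ≤ deg F_i · max_i deg v_i`", "`wt(G_i) ≤ λ^d wt(F_i)(max_i wt(v_i))^d`"):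
  `natDegree_numeratorPoly_le`, `polyWeight_numeratorPoly_le`;
* **Mignotte's bound** in the form used on p. 82–83: a divisor `g ∣ G ≠ 0` in `ℤ[Y]` has
  `wt(g) ≤ 2^{deg G} wt(G)` (`polyWeight_le_two_pow_mul_of_dvd`), from Mathlib's Mahler measure
  (`M(gh) = M(g)M(h)`, `M(h) ≥ 1` for integer `h ≠ 0`, `|g_k| ≤ C(deg g, k) M(g)`, `M(G) ≤ wt(G)`);
* a nonzero integer polynomial vanishing at `y ∈ ℂ` has an irreducible primitive factor of positive
  degree vanishing at `y` (`exists_irreducible_factor_of_aeval_eq_zero`), and an integer polynomial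
  taking finitely many complex values is constant (`natDegree_eq_zero_of_finite_range`) — the two
  case distinctions of the printed proof ("Let `g` be a minimal polynomial of `y`, which we moreover
  assume to be a primitive integer polynomial"; "otherwise all `v_i` are constant, and we are done").

## References
* [Burgisser2000TCS] P. Bürgisser, Cook's versus Valiant's hypothesis, TCS 235 (2000) 71–88, §2 p. 76, §4.1 pp. 82–83.
* M. Mignotte, Some useful bounds, in: Computer Algebra (Buchberger, Collins, Loos eds.), Springer 1982 (Bürgisser's [21]).
-/

noncomputable section

open scoped Classical
open Polynomial Literature.Computability.Complexity Literature.Computability.AlgebraicComplexity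

namespace Literature.Computability.AlgebraicComplexity

/-! ### The `ℓ¹`-API of `polyWeight` -/

section PolyWeight

/-- The weight as a sum over any finite set containing the support. [folklore] -/
theorem polyWeight_eq_sum_of_support_subset (g : ℤ[X]) {S : Finset ℕ} (hS : g.support ⊆ S) :
    polyWeight g = ∑ i ∈ S, (g.coeff i).natAbs := by
  unfold polyWeight
  refine Finset.sum_subset hS fun i _ hi => ?_
  rw [Polynomial.notMem_support_iff.1 hi, Int.natAbs_zero]

/-- The weight as a sum over `range N` for any `N > deg g`. [folklore] -/
theorem polyWeight_eq_sum_range (g : ℤ[X]) {N : ℕ} (hN : g.natDegree < N) :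
    polyWeight g = ∑ i ∈ Finset.range N, (g.coeff i).natAbs :=
  polyWeight_eq_sum_of_support_subset g (Polynomial.supp_subset_range hN)

/-- `wt(0) = 0`. [folklore] -/
@[simp] theorem polyWeight_zero : polyWeight (0 : ℤ[X]) = 0 := by
  simp [polyWeight]

/-- `wt(C c) = |c|`. [folklore] -/
@[simp] theorem polyWeight_C (c : ℤ) : polyWeight (Polynomial.C c) = c.natAbs := by
  rw [polyWeight_eq_sum_range (Polynomial.C c) (N := 1) (by simp)]
  simp

/-- `wt(1) = 1`. [folklore] -/
@[simp] theorem polyWeight_one : polyWeight (1 : ℤ[X]) = 1 := by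
  rw [← Polynomial.C_1, polyWeight_C]; rfl

/-- `wt(X) = 1`. [folklore] -/
@[simp] theorem polyWeight_X : polyWeight (Polynomial.X : ℤ[X]) = 1 := by
  rw [polyWeight_eq_sum_range Polynomial.X (N := 2) (by simp)]
  simp [Finset.sum_range_succ, Polynomial.coeff_X]

/-- Subadditivity `wt(f + g) ≤ wt(f) + wt(g)` (Bürgisser 2000 TCS, p. 76). [cite: Burgisser2000TCS, §2 p. 76] -/
theorem polyWeight_add_le (f g : ℤ[X]) : polyWeight (f + g) ≤ polyWeight f + polyWeight g := by
  set N := max f.natDegree g.natDegree + 1 with hN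
  have hf : f.natDegree < N := by omega
  have hg : g.natDegree < N := by omega
  have hfg : (f + g).natDegree < N := lt_of_le_of_lt (Polynomial.natDegree_add_le f g) (by omega)
  rw [polyWeight_eq_sum_range _ hfg, polyWeight_eq_sum_range _ hf, polyWeight_eq_sum_range _ hg,
    ← Finset.sum_add_distrib]
  exact Finset.sum_le_sum fun i _ => by rw [Polynomial.coeff_add]; exact Int.natAbs_add_le _ _

/-- `wt(∑ᵢ fᵢ) ≤ ∑ᵢ wt(fᵢ)`. [cite: Burgisser2000TCS, §2 p. 76] -/
theorem polyWeight_sum_le {ι : Type*} (s : Finset ι) (f : ι → ℤ[X]) :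
    polyWeight (∑ i ∈ s, f i) ≤ ∑ i ∈ s, polyWeight (f i) := by
  induction s using Finset.cons_induction with
  | empty => simp
  | cons a s ha ih =>
    rw [Finset.sum_cons, Finset.sum_cons]
    exact (polyWeight_add_le _ _).trans (Nat.add_le_add_left ih _)

/-- `wt(C c · f) = |c| wt(f)`. [folklore] -/
theorem polyWeight_C_mul (c : ℤ) (f : ℤ[X]) : polyWeight (Polynomial.C c * f) = c.natAbs * polyWeight f := by
  have h1 : (Polynomial.C c * f).natDegree < f.natDegree + 1 :=
    Nat.lt_succ_of_le (Polynomial.natDegree_C_mul_le c f)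
  rw [polyWeight_eq_sum_range _ h1, polyWeight_eq_sum_range f (Nat.lt_succ_self _), Finset.mul_sum]
  exact Finset.sum_congr rfl fun i _ => by rw [Polynomial.coeff_C_mul, Int.natAbs_mul]

/-- `wt(f · X^k) = wt(f)`. [folklore] -/
theorem polyWeight_mul_X_pow (f : ℤ[X]) (k : ℕ) :
    polyWeight (f * Polynomial.X ^ k) = polyWeight f := by
  have h1 : (f * Polynomial.X ^ k).natDegree < k + (f.natDegree + 1) := by
    have := Polynomial.natDegree_mul_le (p := f) (q := Polynomial.X ^ k)
    have h2 : (Polynomial.X ^ k : ℤ[X]).natDegree ≤ k := Polynomial.natDegree_X_pow_le k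
    omega
  rw [polyWeight_eq_sum_range _ h1, Finset.sum_range_add, polyWeight_eq_sum_range f (Nat.lt_succ_self _)]
  have h0 : ∑ i ∈ Finset.range k, ((f * Polynomial.X ^ k).coeff i).natAbs = 0 := by
    refine Finset.sum_eq_zero fun i hi => ?_
    rw [Finset.mem_range] at hi
    rw [Polynomial.coeff_mul_X_pow', if_neg (by omega), Int.natAbs_zero]
  rw [h0, zero_add]
  exact Finset.sum_congr rfl fun i _ => by rw [add_comm, Polynomial.coeff_mul_X_pow]

/-- Submultiplicativity `wt(f g) ≤ wt(f) wt(g)` (Bürgisser 2000 TCS, p. 76). [cite: Burgisser2000TCS, §2 p. 76] -/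
theorem polyWeight_mul_le (f g : ℤ[X]) : polyWeight (f * g) ≤ polyWeight f * polyWeight g := by
  conv_lhs => rw [Polynomial.as_sum_support_C_mul_X_pow g, Finset.mul_sum]
  refine (polyWeight_sum_le _ _).trans (le_of_eq ?_)
  have key : ∀ i, polyWeight (f * (Polynomial.C (g.coeff i) * Polynomial.X ^ i)) =
      polyWeight f * (g.coeff i).natAbs := fun i => by
    rw [← mul_assoc, mul_comm f, mul_assoc, polyWeight_C_mul, polyWeight_mul_X_pow, mul_comm]
  simp_rw [key, ← Finset.mul_sum]
  rfl

/-- `wt(∏ᵢ fᵢ) ≤ ∏ᵢ wt(fᵢ)`. [cite: Burgisser2000TCS, §2 p. 76] -/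
theorem polyWeight_prod_le {ι : Type*} (s : Finset ι) (f : ι → ℤ[X]) :
    polyWeight (∏ i ∈ s, f i) ≤ ∏ i ∈ s, polyWeight (f i) := by
  induction s using Finset.cons_induction with
  | empty => simp
  | cons a s ha ih =>
    rw [Finset.prod_cons, Finset.prod_cons]
    exact (polyWeight_mul_le _ _).trans (Nat.mul_le_mul_left _ ih)

/-- `wt(f^k) ≤ wt(f)^k`. [cite: Burgisser2000TCS, §2 p. 76] -/
theorem polyWeight_pow_le (f : ℤ[X]) (k : ℕ) : polyWeight (f ^ k) ≤ polyWeight f ^ k := by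
  induction k with
  | zero => simp
  | succ k ih =>
    rw [pow_succ, pow_succ]
    exact (polyWeight_mul_le _ _).trans (Nat.mul_le_mul_right _ ih)

/-- `|coeff| ≤ wt`. [folklore] -/
theorem natAbs_coeff_le_polyWeight (g : ℤ[X]) (i : ℕ) : (g.coeff i).natAbs ≤ polyWeight g := by
  by_cases hi : i ∈ g.support
  · exact Finset.single_le_sum (f := fun i => (g.coeff i).natAbs) (fun _ _ => Nat.zero_le _) hi
  · rw [Polynomial.notMem_support_iff.1 hi, Int.natAbs_zero]; exact Nat.zero_le _

/-- The weight, cast to `ℝ`, is the `ℓ¹`-norm of the coefficient vector of the complexified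
polynomial. [folklore] -/
theorem polyWeight_cast_eq_sum_norm (g : ℤ[X]) :
    (polyWeight g : ℝ) = (g.map (Int.castRingHom ℂ)).sum fun _ a => ‖a‖ := by
  rw [Polynomial.sum_def, Polynomial.support_map_of_injective _ (RingHom.injective_int _),
    polyWeight, Nat.cast_sum]
  refine Finset.sum_congr rfl fun i _ => ?_
  rw [Polynomial.coeff_map, eq_intCast, Complex.norm_intCast, Nat.cast_natAbs, Int.cast_abs]

end PolyWeight

/-! ### Mignotte's bound for integer factors -/

section Mignotte

/-- `wt(g) ≤ 2^{deg g} M(g)` for the complexification of an integer polynomial: sum of the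
coefficient bounds `|g_k| ≤ C(deg g, k) M(g)`. [folklore] -/
theorem polyWeight_le_two_pow_mul_mahlerMeasure (g : ℤ[X]) :
    (polyWeight g : ℝ) ≤ 2 ^ g.natDegree * (g.map (Int.castRingHom ℂ)).mahlerMeasure := by
  set gC := g.map (Int.castRingHom ℂ) with hgC
  have hdeg : gC.natDegree = g.natDegree := Polynomial.natDegree_map_eq_of_injective (RingHom.injective_int _) g
  rw [polyWeight_eq_sum_range g (Nat.lt_succ_self _), Nat.cast_sum]
  calc ∑ i ∈ Finset.range (g.natDegree + 1), (((g.coeff i).natAbs : ℕ) : ℝ)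
      = ∑ i ∈ Finset.range (g.natDegree + 1), ‖gC.coeff i‖ := by
        refine Finset.sum_congr rfl fun i _ => ?_
        rw [hgC, Polynomial.coeff_map, eq_intCast, Complex.norm_intCast, Nat.cast_natAbs, Int.cast_abs]
    _ ≤ ∑ i ∈ Finset.range (g.natDegree + 1), (gC.natDegree.choose i : ℝ) * gC.mahlerMeasure :=
        Finset.sum_le_sum fun i _ => Polynomial.norm_coeff_le_choose_mul_mahlerMeasure i gC
    _ = 2 ^ g.natDegree * gC.mahlerMeasure := by
        rw [← Finset.sum_mul, hdeg, ← Nat.cast_sum, Nat.sum_range_choose]; norm_num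

/-- `M(G) ≤ wt(G)` for the complexification of an integer polynomial. [folklore] -/
theorem mahlerMeasure_map_le_polyWeight (G : ℤ[X]) :
    (G.map (Int.castRingHom ℂ)).mahlerMeasure ≤ polyWeight G := by
  rw [polyWeight_cast_eq_sum_norm]
  exact Polynomial.mahlerMeasure_le_sum_norm_coeff _

/-- **Mignotte's factor bound** in the form used by Bürgisser (2000 TCS, pp. 82–83, citing
Mignotte [21]: "`wt(g) ≤ |lc(g)/lc(G_i)| 2^{deg g} ‖G_i‖` implies the desired estimate of
`wt(g)`"): an integer divisor `g` of a nonzero `G ∈ ℤ[Y]` has `wt(g) ≤ 2^{deg G} wt(G)`. Proof: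
`wt(g) ≤ 2^{deg g} M(g) ≤ 2^{deg g} M(g) M(G/g) = 2^{deg g} M(G) ≤ 2^{deg G} wt(G)`, the Mahler
measure of a nonzero integer polynomial being `≥ 1`. [cite: Burgisser2000TCS, proof of Thm. 4.5 pp. 82–83] -/
theorem polyWeight_le_two_pow_mul_of_dvd {g G : ℤ[X]} (hG : G ≠ 0) (hdvd : g ∣ G) :
    (polyWeight g : ℝ) ≤ 2 ^ G.natDegree * polyWeight G := by
  obtain ⟨h, rfl⟩ := hdvd
  have hh : h ≠ 0 := right_ne_zero_of_mul hG
  have hMh : 1 ≤ (h.map (Int.castRingHom ℂ)).mahlerMeasure := Polynomial.one_le_mahlerMeasure_of_ne_zero hh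
  have hM : (g.map (Int.castRingHom ℂ)).mahlerMeasure ≤ ((g * h).map (Int.castRingHom ℂ)).mahlerMeasure := by
    rw [Polynomial.map_mul, Polynomial.mahlerMeasure_mul]
    exact le_mul_of_one_le_right (Polynomial.mahlerMeasure_nonneg _) hMh
  have hdeg : g.natDegree ≤ (g * h).natDegree := Polynomial.natDegree_le_of_dvd (dvd_mul_right g h) hG
  calc (polyWeight g : ℝ) ≤ 2 ^ g.natDegree * (g.map (Int.castRingHom ℂ)).mahlerMeasure :=
        polyWeight_le_two_pow_mul_mahlerMeasure g
    _ ≤ 2 ^ (g * h).natDegree * (polyWeight (g * h) : ℝ) := by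
        have h2 : (2 : ℝ) ^ g.natDegree ≤ 2 ^ (g * h).natDegree :=
          pow_le_pow_right₀ (by norm_num) hdeg
        exact mul_le_mul h2 (hM.trans (mahlerMeasure_map_le_polyWeight _))
          (Polynomial.mahlerMeasure_nonneg _) (by positivity)

end Mignotte

/-! ### Irreducible factors with a given root; polynomials with finitely many values -/

section Factors

/-- A nonzero integer polynomial vanishing at `y ∈ ℂ` has an irreducible factor vanishing at `y`
(unique factorisation in `ℤ[Y]`; Bürgisser 2000 TCS, p. 82: "Let `g` be a minimal polynomial of
`y`, which we moreover assume to be a primitive integer polynomial … `g` is a divisor of `G_i`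
in `ℤ[Y]`"). [folklore] -/
theorem exists_irreducible_factor_of_aeval_eq_zero {G : ℤ[X]} (hG : G ≠ 0) {y : ℂ}
    (hy : Polynomial.aeval y G = 0) :
    ∃ g : ℤ[X], Irreducible g ∧ g ∣ G ∧ Polynomial.aeval y g = 0 := by
  induction G using UniqueFactorizationMonoid.induction_on_prime with
  | h₁ => exact absurd rfl hG
  | h₂ u hu => exact absurd hy (hu.map (Polynomial.aeval y)).ne_zero
  | h₃ a p ha hp ih =>
    rw [map_mul, mul_eq_zero] at hy
    rcases hy with hpy | hay
    · exact ⟨p, hp.irreducible, dvd_mul_right p a, hpy⟩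
    · obtain ⟨g, hg, hga, hgy⟩ := ih ha hay
      exact ⟨g, hg, hga.trans (dvd_mul_left a p), hgy⟩

/-- An irreducible integer polynomial with a complex root has positive degree and is primitive.
[folklore] -/
theorem natDegree_pos_and_isPrimitive_of_irreducible_of_aeval_eq_zero {g : ℤ[X]}
    (hg : Irreducible g) {y : ℂ} (hy : Polynomial.aeval y g = 0) :
    0 < g.natDegree ∧ g.IsPrimitive := by
  have hdeg : g.natDegree ≠ 0 := by
    intro h0
    rw [Polynomial.eq_C_of_natDegree_eq_zero h0, Polynomial.aeval_C, algebraMap_int_eq, eq_intCast,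
      Int.cast_eq_zero] at hy
    apply hg.ne_zero
    rw [Polynomial.eq_C_of_natDegree_eq_zero h0, hy, map_zero]
  exact ⟨Nat.pos_of_ne_zero hdeg, hg.isPrimitive hdeg⟩

/-- An integer polynomial taking only finitely many values on `ℂ` is constant ("otherwise all
`v_i` are constant, and we are done already", Bürgisser 2000 TCS p. 82). [folklore] -/
theorem natDegree_eq_zero_of_finite_range {v : ℤ[X]}
    (h : (Set.range fun t : ℂ => Polynomial.aeval t v).Finite) : v.natDegree = 0 := by
  by_contra hne
  apply Set.infinite_univ (α := ℂ)
  refine h.subset fun c _ => ?_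
  set vC := v.map (Int.castRingHom ℂ) with hvC
  have hdeg : 0 < vC.degree := by
    rw [hvC, Polynomial.degree_map_eq_of_injective (RingHom.injective_int _)]
    exact Polynomial.natDegree_pos_iff_degree_pos.1 (Nat.pos_of_ne_zero hne)
  have hdeg' : (vC - Polynomial.C c).degree ≠ 0 := by
    rw [Polynomial.degree_sub_C hdeg]; exact hdeg.ne'
  obtain ⟨t, ht⟩ := IsAlgClosed.exists_root _ hdeg'
  refine ⟨t, ?_⟩
  rw [Polynomial.IsRoot, Polynomial.eval_sub, Polynomial.eval_C, sub_eq_zero, hvC,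
    Polynomial.eval_map] at ht
  simpa [Polynomial.aeval_def] using ht

end Factors

/-! ### Degree and weight of the numerator polynomial -/

section Numerator

variable {n : ℕ}

/-- `deg G ≤ D · max_j deg v_j` for `G = numeratorPoly f D λ v` (Bürgisser 2000 TCS, p. 82:
"hence `deg G_i ≤ deg F_i · max_i deg v_i`"). [cite: Burgisser2000TCS, proof of Thm. 4.5 p. 82] -/
theorem natDegree_numeratorPoly_le (f : MvPolynomial (Fin n) ℤ) {D : ℕ} (hD : f.totalDegree ≤ D)
    (lam : ℤ) (v : Fin n → ℤ[X]) {B : ℕ} (hB : ∀ j, (v j).natDegree ≤ B) :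
    (numeratorPoly f D lam v).natDegree ≤ D * B := by
  unfold numeratorPoly
  refine Polynomial.natDegree_sum_le_of_forall_le _ _ fun α hα => ?_
  refine (Polynomial.natDegree_C_mul_le _ _).trans ?_
  refine (Polynomial.natDegree_prod_le _ _).trans ?_
  have hdeg : (α.sum fun _ e => e) ≤ D := (MvPolynomial.le_totalDegree hα).trans hD
  calc ∑ j, ((v j) ^ α j).natDegree ≤ ∑ j, α j * B := Finset.sum_le_sum fun j _ =>
          (Polynomial.natDegree_pow_le).trans (Nat.mul_le_mul_left _ (hB j))
    _ = (∑ j, α j) * B := by rw [Finset.sum_mul]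
    _ ≤ D * B := by
        refine Nat.mul_le_mul_right _ (le_trans (le_of_eq ?_) hdeg)
        rw [Finsupp.sum_fintype]; intro; rfl

/-- `wt(G) ≤ wt(f) λ^D M^D` for `G = numeratorPoly f D λ v`, `M ≥ 1` a bound for the weights
`wt(v_j)` and `λ ≥ 1` (Bürgisser 2000 TCS, p. 82: "Using the subadditivity and
submultiplicativity of the weight we infer that `wt(G_i) ≤ λ^d wt(F_i)(max_i wt(v_i))^d`"). [cite: Burgisser2000TCS, proof of Thm. 4.5 p. 82] -/
theorem polyWeight_numeratorPoly_le (f : MvPolynomial (Fin n) ℤ) {D : ℕ} (hD : f.totalDegree ≤ D)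
    {lam : ℕ} (hlam : 1 ≤ lam) (v : Fin n → ℤ[X]) {M : ℕ} (hM1 : 1 ≤ M)
    (hM : ∀ j, polyWeight (v j) ≤ M) :
    polyWeight (numeratorPoly f D lam v) ≤ weight f * lam ^ D * M ^ D := by
  unfold numeratorPoly
  refine (polyWeight_sum_le _ _).trans ?_
  rw [weight, Finset.sum_mul, Finset.sum_mul]
  refine Finset.sum_le_sum fun α hα => ?_
  have hdeg : (α.sum fun _ e => e) ≤ D := (MvPolynomial.le_totalDegree hα).trans hD
  have hsum : (∑ j, α j) = α.sum fun _ e => e := by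
    rw [Finsupp.sum_fintype]; intro; rfl
  rw [polyWeight_C_mul, Int.natAbs_mul, Int.natAbs_pow, Int.natAbs_natCast]
  have h1 : polyWeight (∏ j, v j ^ α j) ≤ M ^ D := by
    refine (polyWeight_prod_le _ _).trans ?_
    calc ∏ j, polyWeight (v j ^ α j) ≤ ∏ j, M ^ α j := Finset.prod_le_prod' fun j _ =>
            (polyWeight_pow_le _ _).trans (Nat.pow_le_pow_left (hM j) _)
      _ = M ^ (∑ j, α j) := Finset.prod_pow_eq_pow_sum _ _ _
      _ ≤ M ^ D := Nat.pow_le_pow_right hM1 (hsum ▸ hdeg)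
  have h2 : lam ^ (D - α.sum fun _ e => e) ≤ lam ^ D := Nat.pow_le_pow_right hlam (Nat.sub_le _ _)
  calc (f.coeff α).natAbs * lam ^ (D - α.sum fun _ e => e) * polyWeight (∏ j, v j ^ α j)
      ≤ (f.coeff α).natAbs * lam ^ D * M ^ D := by gcongr

end Numerator

end Literature.Computability.AlgebraicComplexity
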